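import Literature.NumberTheory.LFunctions.WeilTwoPrimeCertificateMargin
import HarnessLib

/-!
# Soundness of the two-prime (margin) certificate from a semantically valid cell chain

Topic: `Literature/NumberTheory/LFunctions`. The soundness theorems of the two-prime certificate format
(`WeilCert23.margin_step3`, `WeilCert23.weilTwoPrimeQuadratic_margin_of_parts`; `WeilTwoPrimeCertificate.lean`,
`WeilTwoPrimeCertificateMargin.lean`) take the INTEGER cell check `checkCells₂₃ … = true` as hypothesis and use it only through
`cellsOK_of_checkCells₂₃ : … → CellsOK₂₃ wL T cells`.  The ripple constants of that checker are compared with the fixed-scale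
(`2^48`) interval engine `FI`, whose `cos`/`sin` enclosures are only `10⁻¹¹…5·10⁻⁹` accurate at the arguments `u log 2`, `u log 3`,
`u ≤ 120`; a chain certified by a sharper checker (multi-precision engine `MI`/`MC`) proves `CellsOK₂₃` directly.  This file restates
the two soundness theorems with the hypothesis `CellsOK₂₃` (**`WeilCert23.margin_step3_of_cellsOK`**,
**`WeilCert23.weilTwoPrimeQuadratic_margin_of_cellsOK`**); the proofs are those of the originals verbatim.
Everything here is proved; no named facts.

## References

* H. Yoshida, *On Hermitian forms attached to zeta functions*, Adv. Stud. Pure Math. 21 (1992), §2 (2.1), §6, Theorem 1 (p. 310). [Yoshida1992]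
-/

noncomputable section

open Complex Finset MeasureTheory Set Filter
open scoped Real Topology ComplexConjugate BigOperators

namespace Literature.NumberTheory.LFunctions

open Literature.Analysis.ValidatedNumerics.Numerics
open Literature.Analysis.SpecialFunctions

namespace WeilCert23

variable {c : WeilCert23} {g : ℝ → ℂ}

set_option maxHeartbeats 1600000 in
/-- **The analytic reduction of the two-prime certificate, from a VALID chain** (valid for every test function; variant of
`WeilCert23.margin_step3` whose cell hypothesis is the semantic `CellsOK₂₃` rather than the integer check `checkCells₂₃`, so that
chains certified by other cell checkers can be used): if the chain is valid and the scalar and moment checks pass then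
`Σ_{k,l ≤ N} P_r(k,l) Re(conj M_k M_l) + κ ‖g‖₂² ≤ E₂₃(g)` on `C(b)` — Taylor expansion of the polar
side (Step A), the certified minorant `wL − γ ≤ w₂₃` (Step B), the frequency side in the moments of
`γ` (Step C), twenty-digit `1/(2π)` against the signed `γ` (price `7 (q_hi − q_lo) max_j bnd_j`),
`log π`, and the rounding of the matrix and of the moment table. [folklore] -/
theorem margin_step3_of_cellsOK
    (hcells : CellsOK₂₃ c.base.wL c.base.T c.cells)
    (hsc : c.checkScalars = true) (hnuchk : c.checkNu = true) {g : ℝ → ℂ} (hg : IsWeilTest g)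
    (hsupp : tsupport g ⊆ Icc (-(c.b : ℝ)) c.b) :
    ∑ k ∈ range (c.base.N + 1), ∑ l ∈ range (c.base.N + 1),
        ((c.base.prQ c.nuTab k l : ℚ) : ℝ) *
          (conj (weilMoment c.base.a0 g k) * weilMoment c.base.a0 g l).re +
      ((c.kappaQ : ℚ) : ℝ) * weilNorm2Sq g ≤ weilTwoPrimeQuadratic g := by
  unfold weilTwoPrimeQuadratic
  obtain ⟨-, hbpos, hba, ha1q, -, -, -, hN, -⟩ := scalars_spec hsc
  set a : ℝ := (c.base.a0 : ℝ) with ha_def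
  have hba' : ((c.b : ℚ) : ℝ) ≤ a := by rw [ha_def]; exact_mod_cast hba
  have hb0' : (0 : ℝ) < c.b := by exact_mod_cast hbpos
  have ha : 0 < a := by linarith
  have ha1 : a ≤ 1 := by rw [ha_def]; exact_mod_cast ha1q
  have hsupp' : tsupport g ⊆ Icc (-a) a := hsupp.trans (Icc_subset_Icc (by linarith) hba')
  set n := c.base.N + 1 with hn
  set nu := c.nuTab with hnu
  set M : ℕ → ℂ := weilMoment a g with hM
  set L := weilNorm1 g with hL
  set N2 := weilNorm2Sq g with hN2
  set z : ℕ → ℕ → ℝ := fun k l ↦ (conj (M k) * M l).re with hz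
  have hzsym : ∀ k l, z k l = z l k := fun k l ↦ by
    rw [hz]; simp only; rw [← WeilAna.re_mul_conj_eq, mul_comm]
  have hL0 : 0 ≤ L := weilNorm1_nonneg g
  have hN20 : 0 ≤ N2 := weilNorm2Sq_nonneg g
  have hL1 : L ^ 2 ≤ 2 * a * N2 := weilNorm1_sq_le hg ha hsupp'
  -- the three terms of E(g)
  set P : ℝ := 2 * (weilMellin g 0 * conj (weilMellin g 1)).re with hP
  set A : ℝ := ∫ t : ℝ, ‖weilMellin g (1 / 2 + t * I)‖ ^ 2 * weilTwoPrimeWeight t with hA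
  set Γ : ℝ := ∫ t : ℝ, ‖weilMellin g (1 / 2 + t * I)‖ ^ 2 * cellsGamma₂₃ c.base.wL c.cells t with hΓ
  -- Step A
  set ρ : ℝ := 2 * (a / 2) ^ (c.base.N + 1) / (c.base.N + 1).factorial with hρ
  have hρ0 : 0 ≤ ρ := by positivity
  have hPA : ∑ k ∈ range n, ∑ l ∈ range n,
      (2 * ((-a / 2) ^ k / k.factorial) * ((a / 2) ^ l / l.factorial)) * z k l -
      (8 * ρ + 6 * ρ ^ 2) * L ^ 2 ≤ P := WeilAna.polar_lower_bound hg ha ha1 hsupp' c.base.N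
  rw [WeilCert.polar_symmetrize n a z hzsym] at hPA
  -- Step B
  have hB : (c.base.wL : ℝ) * (2 * π * N2) - Γ ≤ A := arch_lower_bound hcells hg
  -- Step C
  have hC : Γ ≤ ∑ k ∈ range n, ∑ l ∈ range n, gHat c k l * z k l +
      5 * L ^ 2 * (c.nuPrimeAbs : ℝ) := by
    have := freq_integral_bound hcells hsc hg (by rwa [← ha_def])
    rw [← ha_def] at this
    exact this
  -- constants
  set q : ℝ := ((invTwoPiHi20 : ℚ) : ℝ) with hq
  set qLo : ℝ := ((invTwoPiLo20 : ℚ) : ℝ) with hqLo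
  have hq1 : 1 / (2 * π) ≤ q := invTwoPiHi20_ge
  have hq0 : 0 ≤ q := invTwoPiHi20_nonneg
  have hqLo1 : qLo ≤ 1 / (2 * π) := invTwoPiLo20_le
  have hlogpi : Real.log π ≤ ((logPiHi20 : ℚ) : ℝ) := logPiHi20_ge
  have hν0 : 0 ≤ ((c.nuPrimeAbs : ℚ) : ℝ) := by
    unfold nuPrimeAbs
    have h1 : (0 : ℝ) ≤ (cellsAbsMomentQ₂₃ c.base.wL c.cells (c.base.N + 1) : ℝ) := by
      rw [← (integral_stepAux₂₃_mul_pow (wL := c.base.wL) hcells.valid (c.base.N + 1)).2]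
      refine integral_nonneg fun s' ↦ mul_nonneg ((stepAux₂₃_props (wL := c.base.wL)
        hcells.valid).1.choose_spec s').1 ?_
      have hev : Even (c.base.N + 1) := ⟨c.base.nb, by omega⟩
      rw [← hev.pow_abs]; positivity
    push_cast
    have ha0 : (0 : ℝ) ≤ (c.base.a0 : ℝ) := by rw [← ha_def]; exact ha.le
    positivity
  have hpi : 0 < 1 / (2 * π) := by positivity
  -- the signed `Γ`: `−(1/2π)Γ ≥ −qX − (q − qLo)·C₀·7·N2`
  set C₀ : ℝ := ((cellsBndMaxQ₂₃ c.base.wL c.cells : ℚ) : ℝ) with hC₀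
  have hC₀0 : 0 ≤ C₀ := by rw [hC₀]; exact_mod_cast cellsBndMaxQ₂₃_nonneg c.base.wL c.cells
  have hγabs : ∀ t, |cellsGamma₂₃ c.base.wL c.cells t| ≤ C₀ := fun t ↦ by
    rw [hC₀]; exact abs_cellsGamma₂₃_le_bndMax hcells t
  set ind : ℝ → ℝ := Set.indicator (Icc (-(c.base.T : ℝ)) c.base.T) (fun _ ↦ (1 : ℝ)) with hind
  have hind01 : ∀ t, 0 ≤ ind t ∧ ind t ≤ 1 := fun t ↦ by
    rw [hind]; by_cases ht : t ∈ Icc (-(c.base.T : ℝ)) c.base.T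
    · rw [Set.indicator_of_mem ht]; norm_num
    · rw [Set.indicator_of_notMem ht]; norm_num
  have hindm : Measurable ind := by rw [hind]; exact measurable_const.indicator measurableSet_Icc
  set PiT : ℝ := ∫ t : ℝ, ‖weilMellin g (1 / 2 + t * I)‖ ^ 2 * ind t with hPiT
  have hiPiT : Integrable fun t : ℝ ↦ ‖weilMellin g (1 / 2 + t * I)‖ ^ 2 * ind t :=
    integrable_norm_sq_weilMellin_mul hg hindm (A := 1) (B := 0) zero_le_one le_rfl fun t ↦ by
      rw [zero_mul, add_zero, abs_of_nonneg (hind01 t).1]; exact (hind01 t).2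
  obtain ⟨BΓ, hBΓ0, hBΓ⟩ := exists_abs_cellsGamma₂₃_le c.base.wL c.cells
  have hiΓ : Integrable fun t : ℝ ↦
      ‖weilMellin g (1 / 2 + t * I)‖ ^ 2 * cellsGamma₂₃ c.base.wL c.cells t :=
    integrable_norm_sq_weilMellin_mul hg (measurable_cellsGamma₂₃ _ _) hBΓ0 le_rfl (B := 0)
      (fun t ↦ by simpa using hBΓ t)
  have hPiT0 : 0 ≤ PiT := integral_nonneg fun t ↦ mul_nonneg (sq_nonneg _) (hind01 t).1
  have hPiTle : PiT ≤ 7 * N2 := by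
    have h1 : PiT ≤ ∫ t : ℝ, ‖weilMellin g (1 / 2 + t * I)‖ ^ 2 :=
      integral_mono hiPiT (integrable_norm_sq_weilMellin_half_line hg) fun t ↦ by
        simpa using mul_le_mul_of_nonneg_left (hind01 t).2 (sq_nonneg ‖weilMellin g (1 / 2 + t * I)‖)
    rw [integral_norm_sq_weilMellin_half_line hg] at h1
    have h7 : 2 * π ≤ 7 := by linarith [Real.pi_lt_d2]
    nlinarith
  -- `Γ₊ = Γ + C₀ PiT ≥ 0`
  have hΓplus : 0 ≤ Γ + C₀ * PiT := by
    rw [hΓ, hPiT, ← integral_const_mul, ← integral_add hiΓ (hiPiT.const_mul _)]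
    refine integral_nonneg fun t ↦ ?_
    rw [show ‖weilMellin g (1 / 2 + t * I)‖ ^ 2 * cellsGamma₂₃ c.base.wL c.cells t +
        C₀ * (‖weilMellin g (1 / 2 + t * I)‖ ^ 2 * ind t) =
        ‖weilMellin g (1 / 2 + t * I)‖ ^ 2 * (cellsGamma₂₃ c.base.wL c.cells t + C₀ * ind t) by ring]
    refine mul_nonneg (sq_nonneg _) ?_
    by_cases ht : t ∈ Icc (-(c.base.T : ℝ)) c.base.T
    · have : ind t = 1 := by rw [hind, Set.indicator_of_mem ht]
      rw [this, mul_one]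
      linarith [neg_abs_le (cellsGamma₂₃ c.base.wL c.cells t), hγabs t]
    · have : ind t = 0 := by rw [hind, Set.indicator_of_notMem ht]
      have hT' : (c.base.T : ℝ) ≤ |t| := by
        rw [Set.mem_Icc, not_and_or, not_le, not_le] at ht
        rcases ht with ht | ht
        · linarith [neg_abs_le t, le_abs_self t, neg_le_abs t]
        · exact ht.le.trans (le_abs_self t)
      rw [this, mul_zero, add_zero, cellsGamma₂₃_eq_zero hcells hT']
  have hΓlow : -(q * (∑ k ∈ range n, ∑ l ∈ range n, gHat c k l * z k l +
      5 * L ^ 2 * (c.nuPrimeAbs : ℝ))) - (q - qLo) * C₀ * (7 * N2) ≤ -(1 / (2 * π) * Γ) := by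
    have e : -(1 / (2 * π) * Γ) = -(1 / (2 * π)) * (Γ + C₀ * PiT) + 1 / (2 * π) * (C₀ * PiT) := by
      ring
    rw [e]
    have h1 : -q * (Γ + C₀ * PiT) ≤ -(1 / (2 * π)) * (Γ + C₀ * PiT) := by nlinarith
    have h2 : qLo * (C₀ * PiT) ≤ 1 / (2 * π) * (C₀ * PiT) :=
      mul_le_mul_of_nonneg_right hqLo1 (mul_nonneg hC₀0 hPiT0)
    have h3 : q * Γ ≤ q * (∑ k ∈ range n, ∑ l ∈ range n, gHat c k l * z k l +
        5 * L ^ 2 * (c.nuPrimeAbs : ℝ)) := mul_le_mul_of_nonneg_left hC hq0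
    have hqq : 0 ≤ q - qLo := by linarith [invTwoPiLo20_le_invTwoPiHi20]
    have h4 : (q - qLo) * C₀ * PiT ≤ (q - qLo) * C₀ * (7 * N2) :=
      mul_le_mul_of_nonneg_left hPiTle (mul_nonneg hqq hC₀0)
    nlinarith
  -- combine A, B, C
  have hB' : (c.base.wL : ℝ) * N2 - 1 / (2 * π) * Γ ≤ 1 / (2 * π) * A := by
    calc (c.base.wL : ℝ) * N2 - 1 / (2 * π) * Γ
        = 1 / (2 * π) * ((c.base.wL : ℝ) * (2 * π * N2) - Γ) := by field_simp
      _ ≤ 1 / (2 * π) * A := mul_le_mul_of_nonneg_left hB hpi.le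
  have h5 : Real.log π * N2 ≤ ((logPiHi20 : ℚ) : ℝ) * N2 := mul_le_mul_of_nonneg_right hlogpi hN20
  have step1 : ∑ k ∈ range n, ∑ l ∈ range n,
      ((if k % 2 = l % 2 then
        (-1 : ℝ) ^ k * 2 * ((a / 2) ^ k / k.factorial) * ((a / 2) ^ l / l.factorial) else 0) -
        q * gHat c k l) * z k l +
      ((c.base.wL : ℝ) - (logPiHi20 : ℚ) - 7 * (q - qLo) * C₀) * N2 -
      ((8 * ρ + 6 * ρ ^ 2) + 5 * q * (c.nuPrimeAbs : ℝ)) * L ^ 2 ≤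
        P - Real.log π * N2 + 1 / (2 * π) * A := by
    have e1 : ∑ k ∈ range n, ∑ l ∈ range n,
        ((if k % 2 = l % 2 then
          (-1 : ℝ) ^ k * 2 * ((a / 2) ^ k / k.factorial) * ((a / 2) ^ l / l.factorial) else 0) -
          q * gHat c k l) * z k l =
        ∑ k ∈ range n, ∑ l ∈ range n,
          (if k % 2 = l % 2 then
            (-1 : ℝ) ^ k * 2 * ((a / 2) ^ k / k.factorial) * ((a / 2) ^ l / l.factorial) else 0) *
              z k l -
        q * ∑ k ∈ range n, ∑ l ∈ range n, gHat c k l * z k l := by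
      rw [Finset.mul_sum, ← Finset.sum_sub_distrib]
      refine Finset.sum_congr rfl fun k _ ↦ ?_
      rw [Finset.mul_sum, ← Finset.sum_sub_distrib]
      refine Finset.sum_congr rfl fun l _ ↦ ?_
      ring
    rw [e1]
    linarith [hPA, hB', hΓlow, h5]
  -- rounding of the matrix and of the moment table, together: `|prQ − Pexact| ≤ δ`
  have hMk : ∀ k, ‖M k‖ ≤ L := fun k ↦ norm_weilMoment_le hg ha hsupp' k
  set q6 : ℝ := ((invTwoPiHi : ℚ) : ℝ) with hq6
  have hq60 : 0 ≤ q6 := invTwoPiHi_nonneg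
  set δ : ℝ := 1 / 2 ^ c.base.pg + q6 * (1 / 2 ^ c.pnu) with hδ
  have hδ0 : 0 ≤ δ := by rw [hδ]; positivity
  have hround : ∑ k ∈ range n, ∑ l ∈ range n, ((c.base.prQ nu k l : ℚ) : ℝ) * z k l -
      ∑ k ∈ range n, ∑ l ∈ range n,
        ((if k % 2 = l % 2 then
          (-1 : ℝ) ^ k * 2 * ((a / 2) ^ k / k.factorial) * ((a / 2) ^ l / l.factorial) else 0) -
          q * gHat c k l) * z k l ≤ δ * (n : ℝ) ^ 2 * L ^ 2 := by
    refine WeilCert3.quad_rounding_le' n (fun k l ↦ ((c.base.prQ nu k l : ℚ) : ℝ)) _ δ L hδ0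
      (fun k hk l hl ↦ ?_) M hMk
    have h1 : |((c.base.prQ nu k l : ℚ) : ℝ) - ((c.base.pmQ nu k l : ℚ) : ℝ)| ≤ 1 / 2 ^ c.base.pg := by
      rw [abs_sub_comm]
      unfold WeilCert.prQ
      exact abs_cast_sub_ratRd_le c.base.pg (c.base.pmQ nu k l)
    have h2q := abs_pmQ_sub_pmQexact_le hnuchk (by omega : k < c.base.N + 1)
      (by omega : l < c.base.N + 1)
    have h2 : |((c.base.pmQ nu k l : ℚ) : ℝ) - ((pmQexact c k l : ℚ) : ℝ)| ≤ q6 * (1 / 2 ^ c.pnu) := by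
      have h := (Rat.cast_le (K := ℝ)).2 h2q
      rw [hnu, hq6]
      push_cast at h ⊢
      exact h
    have h3 : ((pmQexact c k l : ℚ) : ℝ) =
        (if k % 2 = l % 2 then
          (-1 : ℝ) ^ k * 2 * ((a / 2) ^ k / k.factorial) * ((a / 2) ^ l / l.factorial) else 0) -
          q * gHat c k l := by
      rw [pmQexact_cast, ha_def, hq]
    rw [hδ, ← h3]
    exact (abs_sub_le _ _ _).trans (add_le_add h1 h2)
  -- κ_exact
  have hcoef : 0 ≤ (8 * ρ + 6 * ρ ^ 2) + 5 * q * (c.nuPrimeAbs : ℝ) + δ * (n : ℝ) ^ 2 :=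
    add_nonneg (add_nonneg (by positivity) (mul_nonneg (mul_nonneg (by norm_num) hq0) hν0))
      (by positivity)
  have hkex : ((c.kappaExact : ℚ) : ℝ) =
      ((c.base.wL : ℝ) - (logPiHi20 : ℚ) - 7 * (q - qLo) * C₀) -
        2 * a * ((8 * ρ + 6 * ρ ^ 2) + 5 * q * (c.nuPrimeAbs : ℝ) + δ * (n : ℝ) ^ 2) := by
    rw [hρ, hq, hqLo, hC₀, hn, ha_def, hδ, hq6]
    unfold kappaExact WeilCert.etaP WeilCert.rhoE
    push_cast
    ring
  have hκle : ((c.kappaQ : ℚ) : ℝ) ≤ ((c.kappaExact : ℚ) : ℝ) := by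
    unfold kappaQ; exact_mod_cast ratRd_le c.base.pg _
  -- E ≥ Σ pr z + κ N2
  have h1 : ((c.kappaQ : ℚ) : ℝ) * N2 ≤ ((c.kappaExact : ℚ) : ℝ) * N2 :=
    mul_le_mul_of_nonneg_right hκle hN20
  rw [hkex] at h1
  have h2 := mul_le_mul_of_nonneg_left hL1 hcoef
  linarith [step1, hround, h1, h2]

end WeilCert23

/-- **Soundness of the odd-sector margin certificate from a VALID chain (two-prime format).** Variant of
`WeilCert23.weilTwoPrimeQuadratic_margin_of_parts` with the semantic chain hypothesis `CellsOK₂₃`: if the chain of `c` is valid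
and `c` passes the scalar and moment checks and its ODD block passes `checkBlockK` with a Bessel
coefficient `κ'`, `0 ≤ κ' ≤ κ(c)`, then every ODD test function `g` on `[-b, b]` has
`(κ(c) − κ') ‖g‖₂² ≤ E₂₃(g)` (`E₂₃ = weilTwoPrimeQuadratic`): for odd `g` the even moments
`M_{2i}` vanish, so only the odd block enters the algebraic core; `WeilCert23.margin_step3` gives
`Σ P_r z + κ ‖g‖₂² ≤ E₂₃(g)`, Bessel is applied with the coefficient `κ' ≥ 0`, and the difference
`(κ − κ') ‖g‖₂²` is the margin. [folklore] -/
theorem WeilCert23.weilTwoPrimeQuadratic_margin_of_cellsOK (c : WeilCert23) (κ' : ℚ)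
    (hcells : CellsOK₂₃ c.base.wL c.base.T c.cells)
    (hsc : c.checkScalars = true) (hnu : c.checkNu = true)
    (hblk : c.base.checkBlockK c.nuTab κ' 1 = true) (hκ'0 : 0 ≤ κ') (hκ'le : κ' ≤ c.kappaQ)
    {g : ℝ → ℂ} (hg : IsWeilTest g) (hsupp : tsupport g ⊆ Icc (-(c.b : ℝ)) c.b)
    (hodd : ∀ x, g (-x) = -g x) :
    ((c.kappaQ - κ' : ℚ) : ℝ) * weilNorm2Sq g ≤ weilTwoPrimeQuadratic g := by
  have _ := hκ'le
  obtain ⟨-, hbpos, hba, -, -, -, -, hN, -⟩ := WeilCert23.scalars_spec hsc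
  have hb0' : (0 : ℝ) < c.b := by exact_mod_cast hbpos
  have hba' : ((c.b : ℚ) : ℝ) ≤ (c.base.a0 : ℝ) := by exact_mod_cast hba
  have ha : (0 : ℝ) < (c.base.a0 : ℝ) := by linarith
  have hsupp' : tsupport g ⊆ Icc (-(c.base.a0 : ℝ)) c.base.a0 :=
    hsupp.trans (Icc_subset_Icc (by linarith) hba')
  have step3 := WeilCert23.margin_step3_of_cellsOK hcells hsc hnu hg hsupp
  have hbes := weilNorm2Sq_ge_bessel hg ha hsupp' (c.base.N + 1)
    (c.base.uVec (weilMoment c.base.a0 g))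
  have hcore := WeilCert.core_nonnegK_odd (nu := c.nuTab) (κ := κ') hN hblk
    (weilMoment c.base.a0 g) fun i ↦ weilMoment_even_of_odd hodd _ (even_two_mul i)
  have h4 := mul_le_mul_of_nonneg_left hbes (show (0 : ℝ) ≤ ((κ' : ℚ) : ℝ) by exact_mod_cast hκ'0)
  push_cast
  linarith

end Literature.NumberTheory.LFunctions
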